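/-
Origin: expansion seat `planner-pub-hodgecm-pv11-g2-0`, handover 2026-08-18 (`HOME/pub-hodgecm-pv11-g2/lean/Pv11g2/SupplyArchimedean.lean`, md5 77f00b56, 142 lines);
landed by the gen-6 packager in gate run 22 as `HodgeCM/PerL34/SupplyArchimedean.lean` (import ^import Pv[0-9]+g[0-9]+\.→import HodgeCM.PerL34. ×1; import ^import Pv[0-9]+\.→import HodgeCM.PerL34. ×1; stripped 5 #print/#check/#eval lines).
-/
import Summits.HodgeConjecture.HodgeCM.PerL34.SupplyElementary_2
import Summits.HodgeConjecture.HodgeCM.PerL34.LatticeTheta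

/-!
# Route (E), archimedean input made KERNEL: supply from a Schwartz function over a lattice

Unit `pub-hodgecm-pv11-g2` (DAG node #11, gen 2).  Proposed final place:
`HodgeCM/PerL34/SupplyArchimedean.lean`; import rewrites on landing:
`Pv11.SupplyElementary → HodgeCM.PerL34.SupplyElementary` (gen-1 run-22 file, md5 aac4beac…; the copy
under this unit's root is byte-identical and exists only so that `check-wip` resolves the import),
`Pv11g2.LatticeTheta → HodgeCM.PerL34.LatticeTheta`.

`SupplyElementary.supply₁/₂_of_lattice` (gen 1, KERNEL (E1)–(E4)) takes as SETUP an abstract additive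
group `Λ` with a size function `(ℓ, hℓ0, hℓ)` and an absolutely summable `F : Λ → ℂ` with `F 0 ≠ 0`,
plus the DICTIONARY hypotheses `hval / hcont / heq` on the shell `DS : ThetaSeesawData`.

Here the SETUP block is DISCHARGED in the archimedean-lattice dictionary of `LatticeTheta`:
`Λ := L` a discrete `ℤ`-submodule of a finite-dimensional real normed space `E`,
`F v := f (x₀ + v)` for a Schwartz function `f : 𝓢(E, ℂ)` (the archimedean component `φ_∞`) and a
point `x₀` with `f x₀ ≠ 0`; `ℓ := latticeSize`, `hF := LatticeTheta.summable_norm_translate`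
(absolute convergence of the theta series — the kernel form of `ThetaSeesawData.AbsSummable`).
So after this file the inputs of route (E) that remain HYPOTHESES are exactly the dictionary fields
`hval` (D4: `θ_{φ_N}(g₀,u₀) = Σ_{v ∈ L} φ_∞(x₀ + N v)`), `hcont`, `heq` (D5) and the PRINT leaf
`CharSeparating` (E–W Thm 12.84; being kernel-proved by `pub-hodgecm-pv06-g2`), and — one level up,
in `SupplyDictionary.SupplyBridge` — the named residual `form_of_lift`.

An independent, purely archimedean proof of the limit `Σ_{v ∈ L} f (x₀ + N v) → f x₀` used inside
`supply₁_of_lattice` is `LatticeTheta.tendsto_tsum_translate_nsmul` (dominated convergence with the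
Schwartz majorant); `supply₁_of_schwartz'` below runs route (E) through it and `supply_thetaLift₁`
directly, without any size function.

No statement of the 2001 programme, of PerL or of QW8 is used or cited.
-/

set_option autoImplicit false

noncomputable section

open MeasureTheory Filter Topology
open scoped SchwartzMap
open HodgeCM.PerL34.Seesaw HodgeCM.PerL34.SupplyElementary HodgeCM.PerL34.LatticeTheta

namespace HodgeCM
namespace PerL34
namespace SupplyArchimedean

variable (DS : ThetaSeesawData)

variable {E : Type*} [NormedAddCommGroup E] [NormedSpace ℝ E] [FiniteDimensional ℝ E]

/-- **SUPPLY(t¹) from a Schwartz function over a lattice.**  `supply₁_of_lattice` with its SETUP block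
`(Λ, ℓ, hℓ0, hℓ, F, hF, hF0)` produced from `(L, f, x₀, f x₀ ≠ 0)` by `LatticeTheta.latticeSetup`. -/
theorem supply₁_of_schwartz [CommGroup DS.A₁] [TopologicalSpace DS.A₁] [IsTopologicalGroup DS.A₁]
    [CompactSpace DS.A₁] [MeasurableSpace DS.A₁] [BorelSpace DS.A₁] (ν₁ : Measure DS.A₁)
    [IsFiniteMeasure ν₁] [ν₁.IsOpenPosMeasure] [ν₁.IsMulRightInvariant] (hsep : CharSeparating DS.A₁)
    {B : Type*} [Monoid B] (i : B →* DS.A₁) (w : B → ℂ)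
    (L : Submodule ℤ E) [DiscreteTopology L] (f : 𝓢(E, ℂ)) (x₀ : E) (hx₀ : f x₀ ≠ 0)
    (φN : ℕ → DS.S₁) (g₀ : DS.G) (u₀ : DS.A₁)
    (hval : ∀ N : ℕ, DS.thetaKernel₁ (φN N) g₀ u₀ = ∑' v : L, f (x₀ + ((N • v : L) : E)))
    (hcont : ∀ N : ℕ, Continuous fun u => DS.thetaKernel₁ (φN N) g₀ u)
    (heq : ∀ (N : ℕ) (u : DS.A₁) (t : B),
      DS.thetaKernel₁ (φN N) g₀ (u * i t) = w t * DS.thetaKernel₁ (φN N) g₀ u) :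
    ∃ (N : ℕ) (χ : PontryaginDual DS.A₁),
      DS.thetaLift₁ ν₁ (fun u => ((χ u : Circle) : ℂ)) (φN N) g₀ ≠ 0 ∧
        ∀ t : B, ((χ (i t) : Circle) : ℂ) * w t = 1 := by
  obtain ⟨ℓ, hℓ0, hℓ, hF, hF0⟩ := latticeSetup L f x₀ hx₀
  exact supply₁_of_lattice DS ν₁ hsep i w ℓ hℓ0 hℓ (fun v : L => f (x₀ + (v : E))) hF hF0 φN g₀ u₀
    hval hcont heq

/-- **SUPPLY(t²)**: the same over `W₂`. -/
theorem supply₂_of_schwartz [CommGroup DS.A₂] [TopologicalSpace DS.A₂] [IsTopologicalGroup DS.A₂]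
    [CompactSpace DS.A₂] [MeasurableSpace DS.A₂] [BorelSpace DS.A₂] (ν₂ : Measure DS.A₂)
    [IsFiniteMeasure ν₂] [ν₂.IsOpenPosMeasure] [ν₂.IsMulRightInvariant] (hsep : CharSeparating DS.A₂)
    {B : Type*} [Monoid B] (i : B →* DS.A₂) (w : B → ℂ)
    (L : Submodule ℤ E) [DiscreteTopology L] (f : 𝓢(E, ℂ)) (x₀ : E) (hx₀ : f x₀ ≠ 0)
    (φN : ℕ → DS.S₂) (g₀ : DS.G) (u₀ : DS.A₂)
    (hval : ∀ N : ℕ, DS.thetaKernel₂ (φN N) g₀ u₀ = ∑' v : L, f (x₀ + ((N • v : L) : E)))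
    (hcont : ∀ N : ℕ, Continuous fun u => DS.thetaKernel₂ (φN N) g₀ u)
    (heq : ∀ (N : ℕ) (u : DS.A₂) (t : B),
      DS.thetaKernel₂ (φN N) g₀ (u * i t) = w t * DS.thetaKernel₂ (φN N) g₀ u) :
    ∃ (N : ℕ) (χ : PontryaginDual DS.A₂),
      DS.thetaLift₂ ν₂ (fun u => ((χ u : Circle) : ℂ)) (φN N) g₀ ≠ 0 ∧
        ∀ t : B, ((χ (i t) : Circle) : ℂ) * w t = 1 := by
  obtain ⟨ℓ, hℓ0, hℓ, hF, hF0⟩ := latticeSetup L f x₀ hx₀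
  exact supply₂_of_lattice DS ν₂ hsep i w ℓ hℓ0 hℓ (fun v : L => f (x₀ + (v : E))) hF hF0 φN g₀ u₀
    hval hcont heq

/-- **SUPPLY(t¹), second proof**: through the archimedean dominated-convergence limit
`LatticeTheta.exists_tsum_translate_nsmul_ne_zero` and `supply_thetaLift₁`, with no size function;
the witness level `N` is moreover positive. -/
theorem supply₁_of_schwartz' [CommGroup DS.A₁] [TopologicalSpace DS.A₁] [IsTopologicalGroup DS.A₁]
    [CompactSpace DS.A₁] [MeasurableSpace DS.A₁] [BorelSpace DS.A₁] (ν₁ : Measure DS.A₁)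
    [IsFiniteMeasure ν₁] [ν₁.IsOpenPosMeasure] [ν₁.IsMulRightInvariant] (hsep : CharSeparating DS.A₁)
    {B : Type*} [Monoid B] (i : B →* DS.A₁) (w : B → ℂ)
    (L : Submodule ℤ E) [DiscreteTopology L] (f : 𝓢(E, ℂ)) (x₀ : E) (hx₀ : f x₀ ≠ 0)
    (φN : ℕ → DS.S₁) (g₀ : DS.G) (u₀ : DS.A₁)
    (hval : ∀ N : ℕ, DS.thetaKernel₁ (φN N) g₀ u₀ = ∑' v : L, f (x₀ + ((N • v : L) : E)))
    (hcont : ∀ N : ℕ, Continuous fun u => DS.thetaKernel₁ (φN N) g₀ u)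
    (heq : ∀ (N : ℕ) (u : DS.A₁) (t : B),
      DS.thetaKernel₁ (φN N) g₀ (u * i t) = w t * DS.thetaKernel₁ (φN N) g₀ u) :
    ∃ (N : ℕ) (χ : PontryaginDual DS.A₁), 0 < N ∧
      DS.thetaLift₁ ν₁ (fun u => ((χ u : Circle) : ℂ)) (φN N) g₀ ≠ 0 ∧
        ∀ t : B, ((χ (i t) : Circle) : ℂ) * w t = 1 := by
  obtain ⟨N, hNpos, hN⟩ := exists_tsum_translate_nsmul_ne_zero L f x₀ hx₀
  have hne : ∃ u, DS.thetaKernel₁ (φN N) g₀ u ≠ 0 := ⟨u₀, by rw [hval N]; exact hN⟩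
  obtain ⟨χ, h1, h2⟩ := supply_thetaLift₁ DS ν₁ hsep i w (φN N) g₀ (hcont N) hne (heq N)
  exact ⟨N, χ, hNpos, h1, h2⟩

/-- In the same dictionary the shell hypothesis `ThetaSeesawData.AbsSummable₁` HOLDS whenever the
evaluation `ev₁` of the shell is (translated) restriction of Schwartz functions to a lattice:
`X₁ ↪ L` via an injection `e`, `ev₁ ψ v := s ψ (x + e v)` for some map `s : S₁ → 𝓢(E, ℂ)` (e.g. the
identity when `S₁` is the Schwartz space itself and `X₁ = L`). -/
theorem absSummable₁_of_schwartz (L : Submodule ℤ E) [DiscreteTopology L] (e : DS.X₁ → L)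
    (he : Function.Injective e) (s : DS.S₁ → 𝓢(E, ℂ)) (x : E)
    (hev : ∀ (ψ : DS.S₁) (v : DS.X₁), DS.ev₁ ψ v = s ψ (x + ((e v : L) : E))) :
    DS.AbsSummable₁ := by
  intro ψ
  have h := (summable_norm_translate L (s ψ) x).comp_injective he
  refine h.congr fun v => ?_
  simp [Function.comp, hev]

/-- The same for `AbsSummable₂`. -/
theorem absSummable₂_of_schwartz (L : Submodule ℤ E) [DiscreteTopology L] (e : DS.X₂ → L)
    (he : Function.Injective e) (s : DS.S₂ → 𝓢(E, ℂ)) (x : E)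
    (hev : ∀ (ψ : DS.S₂) (v : DS.X₂), DS.ev₂ ψ v = s ψ (x + ((e v : L) : E))) :
    DS.AbsSummable₂ := by
  intro ψ
  have h := (summable_norm_translate L (s ψ) x).comp_injective he
  refine h.congr fun v => ?_
  simp [Function.comp, hev]

end SupplyArchimedean
end PerL34
end HodgeCM

end

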